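import Summits.AtomisticToContinuum.HydrodynamicLimit.Theorems.AntiMazurCoboundariesCorrectorPressureDecayKiferTangent
import Literature.MathematicalPhysics.KineticTheory.RegularStationaryState
import Literature.MathematicalPhysics.StatisticalMechanics.SpecificRelativeEntropy
import Literature.Analysis.FluidPDE.InfiniteHardSphereFlow
import Literature.Analysis.FluidPDE.InfiniteHardSphereDynamics
import Literature.MathematicalPhysics.KineticTheory.HardSphereEulerProofs
import Mathlib.InformationTheory.KullbackLeibler.Basic

/-!
# Stub `stub_tangentEntropy` of line `FirstLemma` (idea `kifer-compactification`) — crux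
stmt-AtomisticToContinuum-14135 `AntiMazurCoboundaries.CorrectorPressureDecay`: INVENTORY, VERDICT, CORRECTED
STATEMENT AND ITS PRECISE DEBT (lead a1 / wave-2 worker; lands the corrected statement, its two typed debts and the
bookkeeping `stub_tangentEntropyOfFacts`; `rc 0`, no `sorry`)

Registered stub: `theorem stub_tangentEntropy : TangentEntropy` (namespace
`Summit.AtomisticToContinuum.HydrodynamicLimit.Theorems.KiferCompactification`; `TangentEntropy` is the tree
def of `…Theorems/AntiMazurCoboundariesCorrectorPressureDecayKiferTangent.lean`, p138873 ACCEPTED).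

## 1. Verdict: TRUE AT LOW DENSITY, MIS-STATED AS REGISTERED (the smallness of `σ` is missing)

`TangentEntropy` quantifies `∀ σ > 0` but concludes with a Gibbs state of ACTIVITY `z ≤ 2σ³`. The activity of
the unit-diameter hard-sphere gas at number density `ρ = σ³` is `z(ρ) = ρ · (G{no centre within distance 1 of
the origin})⁻¹ = ρ + 2B₂ρ² + O(ρ³)`, `B₂ = 2π/3` (GNZ equation / Ruelle 1969 §4.2 (2.31)); `z(ρ) ≤ 2ρ` holds
only for `ρ ≲ 0.14` (`σ ≲ 0.52`; Carnahan–Starling numerics, rigorous only as `z = ρ + O(ρ²)`). Paper-level counterexample at `σ = 1` (any `θ, u₀, a, κ`; weight `φ ≡ 1`):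
* the family `N k + 1 = (k+1)³`, `Φ k` = the torus hard-sphere flow (tree: `HardSphereFlow.nonempty_torus_holds`),
  `Q k = G_{N k}` (the homogeneous canonical law `localGibbsLaw σ (fun _ => a) (fun _ => u₀) (fun _ => θ)`, a
  probability law since density `1 <` close packing `√2`, stationary under `Φ k` by conservation of
  `Σ|vᵢ − u₀|²`, Liouville measure and the hard-sphere domain) is a tangent family with `KL(Q k ‖ G_{N k}) = 0`;
* tangent states `μ` exist (local counts are tight by the hard core; Kallenberg Thm 16.16), are translation
  invariant, and have density exactly `σ³ = 1` (`(N+1) ε_N³ = σ³`, `succ_mul_hsDiameter_pow_three`);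
* the conclusion forces `specificRelEntropy μ G = 0` for a translation-invariant `G` with
  `IsHardSphereGibbs 1 z θ⁻¹ u₀ G`, `z ≤ 2`; by the variational principle (Georgii–Zessin 1993 Thm 3.3 /
  Georgii 1994: zero specific relative entropy w.r.t. a Gibbs state ⇒ Gibbs for the same specification) `μ` is
  then a translation-invariant Gibbs state of activity `z ≤ 2`, so its density is
  `ρ_μ = z · μ{B(0,1) free of centres} ≤ z · (1 − μ{a centre in B(0,½)}) = z (1 − ρ_μ · π/6)` (at most one
  centre fits in `B(0,½)`), i.e. `1 ≤ 2 (1 − π/6) ≈ 0.95` — contradiction.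
Hence no proof of the registered signature can exist; what the line USES (the assembly `stub_tangentAssembly`
applies `TangentEntropy` only at `σ < min (1/2) (z₀/2)`) and what the literature gives (Ruelle's LOW-ACTIVITY
theorem) is the statement BELOW A DENSITY THRESHOLD. Corrected statement: `TangentEntropyLowDensity` (this
file) = `TangentEntropy` with the prefix `∀ σ a θ u₀ κ, 0 < σ → …` replaced by
`∃ σ₁ > 0, ∀ σ a θ u₀ κ, 0 < σ → σ < σ₁ → …`, everything else verbatim. Patch for the assembly: obtain
`⟨σ₁, hσ₁, hE⟩` first and take the threshold `min (min (1/2) (z₀/2)) σ₁`; three lines change.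

## 2. Inventory (what the tree has, `lean search` 2026-08-17)

HAS (all PROVED unless marked "def"):
* `Literature.MathematicalPhysics.KineticTheory.PointProcess` (`RegularStationaryState.lean`): defs `windowRestrict`,
  `windowLaw`, `density`, `IsBox`, `centredBox`, `IsEntropyRegular`, `specificRelEntropy` (a `limsup` of
  `klDiv (windowLaw (centredBox n) μ) (windowLaw (centredBox n) g) / volume (centredBox n)`),
  `laplaceFunctional`, `IsVagueClusterPoint`, `blowUpPoint`, `blowUp`, `ovyLaplace`, `IsOVYLimitState`;
  lemmas `isProbabilityMeasure_windowLaw`, `IsEntropyRegular.specificRelEntropy_le/_lt_top`,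
  `isEntropyRegular_self`, `isBox_centredBox`, `measurable_pointSum`, `finsum_mem_eq_toReal_tsum`.
* `Literature.MathematicalPhysics.StatisticalMechanics` (`SpecificRelativeEntropy.lean`, the general-`d` TWIN on
  open cubes `(-n, n)^d`): defs `window`, `windowLaw`, `windowRelEntropy`, `box`, `cube`, `unitCube`,
  `intensity`, `specificRelativeEntropy`, `HasFiniteSpecificEntropy`, `HasLocallyFiniteIntensity`; the named
  fact `GeorgiiZessin1993_specificEntropy` (existence of the specific entropy RELATIVE TO THE FREE POISSON GAS
  and `= sup` over cubes) DISCHARGED in `SpecificRelativeEntropyProofs.lean`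
  (`GeorgiiZessin1993_specificEntropy_holds`) together with reusable pieces: `klDiv_map_eq_of_leftInvOn`,
  `klDiv_map_fst_add_klDiv_map_snd_le` (super-additivity of KL over a PRODUCT reference),
  `windowRelEntropy_union_ge`, `windowRelEntropy_mono_set`, `pow_mul_windowRelEntropy_box_le_cube`,
  `IsPoissonPointProcess.isTranslationInvariant`.  NOTE: `TangentEntropy` uses the `KineticTheory.PointProcess`
  notion (centred half-open cubes), not this twin; no compatibility lemma exists.
* `Literature.Analysis.FluidPDE` (`InfiniteHardSphereFlow.lean`): defs `IsHardCore`, `IsTranslationInvariant`,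
  `superposeIn`, `HardCoreIn`, `maxwellPhaseMeasure`, `gibbsWeight`, `gibbsSpec`, `IsHardSphereGibbs` (DLR);
  named facts `InfiniteHardSphereFlow.nonempty/unique` (defs, Alexander 1976). `InfiniteHardSphereDynamics.lean`:
  `windowSum(Real)`, `intensity`, `localConfig`, `localLaw`, `localLawTimeAvg` (OVY's `Q^ε`), no limit theorem.
* `StatisticalMechanics/HardSphereGibbs(Proofs|State).lean`: the `d = 3` twin `HardSphere.IsGibbs/gibbsSpec`
  with kernel API (`isProbabilityMeasure_gibbsSpec`, `gibbsSpec_map_restrict_compl`, …), the bundle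
  `HardSphereGibbsState` (parameters + DLR law; NO existence), `HasEulerParameters`.
  `HardSphereKirkwoodSalsburg.lean`: Ruelle's KS fixed point `ksCorr` (correlation FUNCTIONS at small
  activity, `ksOp_ksCorr`, `eq_ksCorr_of_fixed`, translation invariance `ksCorr_const_add`) — functions only,
  NO measure is built from them.
* Divergences: `Literature.Probability.Divergences.klDiv_le_of_forall_integral_le` (DV hard half),
  `integral_le_toReal_klDiv_add_log` (easy half), `klDiv_sum_smul_le` / `klDiv_cesaro_le` (convexity in the
  first argument), `klDiv_fst_prod_le_of_forall`; Mathlib `InformationTheory.klDiv` basic API (no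
  data-processing lemma at this pin; the tree's substitute is `klDiv_map_eq_of_leftInvOn`).
LACKS (searched: `LowActivityGibbsState_holds`, `lowActivityGibbsState`, `exists.*IsHardSphereGibbs`,
`IsHardSphereGibbs .*:=` constructions, `specificRelEntropy` LSC / affinity, `localLaw` limit theorems):
* ANY construction of a measure satisfying `IsHardSphereGibbs` (the route item
  `Theses.RelEntropyErgodic.LowActivityGibbsState` — existence of translation-invariant hard-sphere Gibbs
  states at small activity, Ruelle 1969 Thm 4.2.3 — is a `def … : Prop`, closed·moot, unproved; no `_holds`);
  a fortiori no state of PRESCRIBED DENSITY and no activity–density relation `z(ρ) = ρ + O(ρ²)`.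
* The thermodynamic / local limit of the blown-up canonical laws `G_N` (equivalence of ensembles), tightness
  of blow-ups, identification of limit points as Gibbs states.
* Lower semicontinuity and affinity of `specificRelEntropy` w.r.t. an INTERACTING (Gibbs) reference, the
  approximate super-additivity of `KL(· ‖ G_N)` over macroscopic cells (Georgii–Zessin 1993 Prop. 2.6 and §3,
  OVY 1993 Lemma 4.2) — i.e. the level-3 specific-entropy theory the stub needs.
Playbook: none fit.

## 3. The precise debt of the corrected statement: two facts (typed `Prop`s, NOT claimed here)

* `DiluteGibbsState` (F1; Ruelle 1969 §4.2 Thm 4.2.3 with (2.31) `ρ = z + Σ_{n≥2} n b_n zⁿ`, and the DLR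
  property of the infinite-volume low-activity state, Ruelle 1970 / Georgii–Zessin 1993 §3): there is
  `σ₁ > 0` such that for `0 < σ < σ₁`, every `θ > 0` and drift `u₀` the unit-diameter hard-sphere gas has a
  translation-invariant Gibbs state `G`, `IsHardSphereGibbs 1 z θ⁻¹ u₀ G`, of density EXACTLY `σ³`
  (`PointProcess.density G = σ³`) and activity `0 < z ≤ 2σ³`.
* `TangentEntropyBound` (F2; Georgii–Zessin 1993 Prop. 2.6 + §3 (LSC of window entropies under local
  convergence, affinity over translation-invariant mixtures), OVY 1993 Lemma 4.2 (the finite-`N` entropy bound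
  passes to limit points, super-additivity over disjoint macroscopic cells up to `o(N)` at low density),
  equivalence of ensembles at low density (the local limit of `G_N` is the `G` of F1)): there is `σ₂ > 0` such
  that for `0 < σ < σ₂`, every tangent family, every translation-invariant probability tangent state `μ` seen
  through the weight `φ`, and every translation-invariant `G` with `IsHardSphereGibbs 1 z θ⁻¹ u₀ G` of density
  `σ³`: `specificRelEntropy μ G ≤ (∫φ)⁻¹ · σ³ · liminf_k (N(ι k)+1)⁻¹ KL(Q(ι k) ‖ G_{N(ι k)})` (the constant:
  `σ³` = particles per unit blown-up volume, `(∫φ)⁻¹ ≥ sup φ/∫φ` because `φ ≤ 1`).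
`tangentEntropyLowDensity_of_facts : DiluteGibbsState → TangentEntropyBound → TangentEntropyLowDensity` is the
bookkeeping (PROVED, threshold `min σ₁ σ₂`); `tangentEntropyLowDensity_of_tangentEntropy` records that the
registered statement is formally stronger.
-/

noncomputable section

open MeasureTheory ProbabilityTheory Set Filter Topology

namespace Summit.AtomisticToContinuum.HydrodynamicLimit.Theorems.KiferCompactification

open Literature.MathematicalPhysics.KineticTheory (T3 V3 hsDiameter localGibbsLaw blowUpPoint)
open Literature.MathematicalPhysics.KineticTheory.PointProcess (laplaceFunctional specificRelEntropy)
open Literature.Analysis.FluidPDE (HardSphereFlow Config IsHardSphereGibbs IsTranslationInvariant windowSumReal)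
open Literature.Analysis.FunctionSpaces (PointConfig)

/-! ## The corrected statement -/

/-- **ENTROPY LOWER SEMICONTINUITY ALONG TANGENT STATES, AT LOW DENSITY** — the corrected form of the tree's
`TangentEntropy`: there is a density threshold `σ₁ > 0` such that for reduced diameters `0 < σ < σ₁` (all the
assembly `stub_tangentAssembly` uses), along every translation-invariant probability tangent state `μ` of a
tangent family seen through the weight `φ`, SOME translation-invariant dilute Gibbs state `G` of the blown-up
gas (unit diameter, activity `0 < z ≤ 2σ³`, inverse temperature `θ⁻¹`, drift `u₀`) satisfies
`specificRelEntropy μ G ≤ (∫φ)⁻¹ σ³ liminf_k KL(Q(ι k) ‖ G_{N(ι k)})/(N(ι k)+1)`. Verbatim `TangentEntropy`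
except for the leading `∃ σ₁ > 0` and the extra hypothesis `σ < σ₁`. Posited; infrastructure
(Georgii–Zessin 1993, OVY 1993 Lemma 4.2, Ruelle 1969 §4.2). -/
def TangentEntropyLowDensity : Prop :=
  ∃ σ₁ : ℝ, 0 < σ₁ ∧
  ∀ (σ a θ : ℝ) (u₀ : V3) (κ : ℝ), 0 < σ → σ < σ₁ → 0 < a → 0 < θ → 0 < κ →
  ∀ (φ : T3 → ℝ), Continuous φ → (∀ x, 0 ≤ φ x) → (∀ x, φ x ≤ 1) → 0 < ∫ x, φ x →
  ∀ (N : ℕ → ℕ)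
    (Φ : ∀ k, HardSphereFlow (Literature.Analysis.FluidPDE.Torus.geometry (Fin 3)) (hsDiameter σ (N k)) (N k + 1))
    (Q : ∀ k, Measure (Config (N k + 1) (Fin 3) T3)),
    IsTangentFamily σ a θ u₀ κ N Φ Q →
    ∀ (ι : ℕ → ℕ) (μ : Measure (PointConfig (V3 × V3))), IsTangentState σ φ N Q ι μ →
      IsProbabilityMeasure μ → IsTranslationInvariant μ →
      ∃ (z : ℝ) (G : Measure (PointConfig (V3 × V3))), 0 < z ∧ z ≤ 2 * σ ^ 3 ∧
        IsHardSphereGibbs 1 z θ⁻¹ u₀ G ∧ IsTranslationInvariant G ∧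
        specificRelEntropy μ G ≤ ENNReal.ofReal ((∫ x, φ x)⁻¹ * σ ^ 3 *
          liminf (fun k => ((N (ι k) + 1 : ℕ) : ℝ)⁻¹ *
            (InformationTheory.klDiv (Q (ι k))
              (localGibbsLaw σ (fun _ => a) (fun _ => u₀) (fun _ => θ) (N (ι k)) (Φ (ι k)))).toReal) atTop)

/-- The registered statement is formally stronger than the corrected one (threshold `σ₁ = 1`, hypothesis
`σ < σ₁` discarded) — recorded so that nothing downstream is lost by the correction. -/
theorem tangentEntropyLowDensity_of_tangentEntropy (h : TangentEntropy) : TangentEntropyLowDensity :=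
  ⟨1, one_pos, fun σ a θ u₀ κ hσ _ => h σ a θ u₀ κ hσ⟩

/-! ## The debt: two typed facts (posited, not claimed) -/

/-- **F1 — DILUTE TRANSLATION-INVARIANT HARD-SPHERE GIBBS STATE OF PRESCRIBED DENSITY** (Ruelle 1969 §4.2,
Thm 4.2.3: for small activity `z` the Kirkwood–Salsburg / Mayer series define a translation-invariant
infinite-volume equilibrium state of the hard-sphere gas whose density `ρ(z) = z + Σ_{n ≥ 2} n b_n zⁿ`
((2.31), (5.28)) is analytic with `ρ'(0) = 1`; it satisfies the DLR equations (Ruelle 1970, Thm 5.5;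
Georgii–Zessin 1993 §3); inverting, every small density `ρ = σ³` is attained at an activity
`z = ρ + 2B₂ρ² + O(ρ³) ≤ 2ρ`, `B₂ = 2π/3` for unit diameter; velocities are i.i.d. Maxwellian
`M_{θ⁻¹}(v − u₀)`, which does not affect positions): there is `σ₁ > 0` such that for `0 < σ < σ₁`, `θ > 0`,
`u₀ ∈ ℝ³` there are `0 < z ≤ 2σ³` and a law `G` with `IsHardSphereGibbs 1 z θ⁻¹ u₀ G`,
`IsTranslationInvariant G` and `PointProcess.density G = σ³`. Strengthens the route item
`Theses.RelEntropyErgodic.LowActivityGibbsState` (existence only) by the density clause. NOT in the tree. -/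
def DiluteGibbsState : Prop :=
  ∃ σ₁ : ℝ, 0 < σ₁ ∧ ∀ σ : ℝ, 0 < σ → σ < σ₁ → ∀ θ : ℝ, 0 < θ → ∀ u₀ : V3,
    ∃ (z : ℝ) (G : Measure (PointConfig (V3 × V3))), 0 < z ∧ z ≤ 2 * σ ^ 3 ∧
      IsHardSphereGibbs 1 z θ⁻¹ u₀ G ∧ IsTranslationInvariant G ∧
      Literature.MathematicalPhysics.KineticTheory.PointProcess.density G = ENNReal.ofReal (σ ^ 3)

/-- **F2 — THE SPECIFIC-ENTROPY BOUND FOR TANGENT STATES** (Georgii–Zessin 1993, Prop. 2.6 and §3: lower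
semicontinuity of the window relative entropies `KL(μ_Λ ‖ G_Λ)` under convergence of the window laws
(Donsker–Varadhan variational formula; tree: `klDiv_le_of_forall_integral_le`) and affinity of the specific
relative entropy over translation-invariant mixtures; Olla–Varadhan–Yau 1993, Lemma 4.2: a bound
`H_N(Q ‖ G_N) ≤ C N` passes to every limit point of the blown-up space averages as `h(μ ‖ ·) ≤ C'`, by
super-additivity of the relative entropy over disjoint macroscopic cells, here w.r.t. the canonical
hard-sphere reference up to `o(N)` boundary/ensemble corrections at low density, and the identification of
the local limit of `G_N` with the translation-invariant Gibbs state of density `σ³` (equivalence of ensembles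
at low density, Ruelle 1969 §4.2–4.3)). Statement: there is `σ₂ > 0` such that for `0 < σ < σ₂`, every
tangent family `(N, Φ, Q)` with budget `κ`, every weight `0 ≤ φ ≤ 1` with `∫φ > 0`, every
translation-invariant probability tangent state `μ` along `ι`, and every translation-invariant `G` with
`IsHardSphereGibbs 1 z θ⁻¹ u₀ G` (`z > 0`) of density `σ³`:
`specificRelEntropy μ G ≤ (∫φ)⁻¹ · σ³ · liminf_k (N(ι k)+1)⁻¹ KL(Q(ι k) ‖ G_{N(ι k)})` — `σ³` is the number
of particles per unit blown-up volume (`(N+1) ε_N³ = σ³`), `(∫φ)⁻¹` bounds the mixture weights `φ/∫φ`.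
NOT in the tree (no LSC / affinity / cell super-additivity for `specificRelEntropy`). -/
def TangentEntropyBound : Prop :=
  ∃ σ₂ : ℝ, 0 < σ₂ ∧
  ∀ (σ a θ : ℝ) (u₀ : V3) (κ : ℝ), 0 < σ → σ < σ₂ → 0 < a → 0 < θ → 0 < κ →
  ∀ (φ : T3 → ℝ), Continuous φ → (∀ x, 0 ≤ φ x) → (∀ x, φ x ≤ 1) → 0 < ∫ x, φ x →
  ∀ (N : ℕ → ℕ)
    (Φ : ∀ k, HardSphereFlow (Literature.Analysis.FluidPDE.Torus.geometry (Fin 3)) (hsDiameter σ (N k)) (N k + 1))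
    (Q : ∀ k, Measure (Config (N k + 1) (Fin 3) T3)),
    IsTangentFamily σ a θ u₀ κ N Φ Q →
    ∀ (ι : ℕ → ℕ) (μ : Measure (PointConfig (V3 × V3))), IsTangentState σ φ N Q ι μ →
      IsProbabilityMeasure μ → IsTranslationInvariant μ →
    ∀ (z : ℝ) (G : Measure (PointConfig (V3 × V3))), 0 < z → IsHardSphereGibbs 1 z θ⁻¹ u₀ G →
      IsTranslationInvariant G →
      Literature.MathematicalPhysics.KineticTheory.PointProcess.density G = ENNReal.ofReal (σ ^ 3) →
      specificRelEntropy μ G ≤ ENNReal.ofReal ((∫ x, φ x)⁻¹ * σ ^ 3 *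
        liminf (fun k => ((N (ι k) + 1 : ℕ) : ℝ)⁻¹ *
          (InformationTheory.klDiv (Q (ι k))
            (localGibbsLaw σ (fun _ => a) (fun _ => u₀) (fun _ => θ) (N (ι k)) (Φ (ι k)))).toReal) atTop)

/-! ## Bookkeeping: the two facts give the corrected statement -/

/-- **The corrected stub from its debt** (pure bookkeeping): below `min σ₁ σ₂` take the dilute Gibbs state
`G` of density `σ³` and activity `z ≤ 2σ³` from F1 and bound `specificRelEntropy μ G` by F2. -/
theorem tangentEntropyLowDensity_of_facts (h₁ : DiluteGibbsState) (h₂ : TangentEntropyBound) :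
    TangentEntropyLowDensity := by
  obtain ⟨σ₁, hσ₁, h₁⟩ := h₁
  obtain ⟨σ₂, hσ₂, h₂⟩ := h₂
  refine ⟨min σ₁ σ₂, lt_min hσ₁ hσ₂, ?_⟩
  intro σ a θ u₀ κ hσ hσlt ha hθ hκ φ hφ hφ0 hφ1 hφi N Φ Q hfam ι μ hμ hμP hμT
  obtain ⟨z, G, hz, hz2, hG, hGT, hGd⟩ := h₁ σ hσ (hσlt.trans_le (min_le_left _ _)) θ hθ u₀
  exact ⟨z, G, hz, hz2, hG, hGT, h₂ σ a θ u₀ κ hσ (hσlt.trans_le (min_le_right _ _)) ha hθ hκ φ hφ hφ0 hφ1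
    hφi N Φ Q hfam ι μ hμ hμP hμT z G hz hG hGT hGd⟩

/-- Registered stub `stub_tangentEntropyOfFacts` (line `FirstLemma`): the corrected entropy statement from its two typed
debts (F1 dilute Gibbs state of prescribed density, F2 the specific-entropy bound). -/
theorem stub_tangentEntropyOfFacts : DiluteGibbsState → TangentEntropyBound → TangentEntropyLowDensity :=
  tangentEntropyLowDensity_of_facts

end Summit.AtomisticToContinuum.HydrodynamicLimit.Theorems.KiferCompactification


end
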